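import Summits.BirchSwinnertonDyer.BirchSwinnertonDyer.Theses.NormCapitulation

/-!
# Evidence (crux-strategist s1, crux stmt-BirchSwinnertonDyer-15277): the deciding theorem of route
# `NormCapitulation` re-glued WITHOUT `R = ShaCotorsionReducible` — SAME IMPORT CONE as the route file

`closes : UniversalNorm → PhantomCapitulation → NormHerbrandBound → CapitulationSqueeze → SelmerRankUB →
SelmerRankLB → SelmerRankSmallImage → ShaCotorsionReducible → Assembly → BirchSwinnertonDyer` (route file,
rev 10) applies `R` only in the branch where the good ordinary prime `p ≥ 5` has `E[p]` REDUCIBLE. That branch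
is DERIVABLE from the other seven non-assembly hypotheses (landed: `Theorems/NormCapitulationClosesWithoutR.lean`,
p171198, `normCapitulation_shaCotorsionReducible_of_items`): at an auxiliary good ordinary `q ≥ 5` with `E[q]`
irreducible the junction gives `corank Ш[q^∞] = 0` and the image dichotomy `corank Sel_{q^∞} = r_an`, so
Greenberg's identity (`WeierstrassCurve.selmerCorank_eq_mordellWeilRank_add_holds`, in the route's cone via
`SelmerCorankHolds`) gives `rank = r_an`; at the Eisenstein `p` the dichotomy gives `corank Sel_{p^∞} = r_an =
rank` and the identity gives `corank Ш[p^∞] = 0`.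

The auxiliary prime comes from the PROVED tree theorem
`WeierstrassCurve.exists_gt_mem_goodOrdinaryPrimes_hasIrreducibleModPGaloisRep W 4`
(`Literature/NumberTheory/EllipticCurves/ModPIrreducibleCofinite`), which is NOT in the route file's import
cone. Exactly as lead c3 did for the sister route (`Cruxes/ShaCotorsionReducible/ClosesWithSupply.lean` →
`ShadowIsolation` rev 4), the theorem below therefore takes the supply as a HYPOTHESIS `hPS` whose statement is
VERBATIM the sister route's support item `ShadowIsolation.PrimeSupplyIrreducible` (stmt-BirchSwinnertonDyer-15491,
ALREADY CLOSED: `primeSupplyIrreducible_proof`). Its only import is the route file: the module cone is unchanged.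

TENURE-PLANNER RECIPE (a strategist never edits `closes`; this file is the certified body to paste):
1. `ledger workitem add --kind statement --route route-BirchSwinnertonDyer-NormCapitulation --rank 9
   --name PrimeSupplyIrreducible --signature '<the binder type of hPS below>' --informal '[support] irreducible
   good ordinary prime supply (= stmt-15491, proved)'` — deduplicated onto stmt-15491 by normalised signature;
2. `ledger route edit route-BirchSwinnertonDyer-NormCapitulation --closes-file <this theorem renamed closes,
   with (hPS : PrimeSupplyIrreducible)>` — BC6 then reports `ShaCotorsionReducible` declared-not-in-cone:
   `--retriage '{"ShaCotorsionReducible": {"kind": "aside"}}'` on the same or the next edit;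
3. nothing else changes: items #2 #3 #8 #9 (junction), 0130/0131/14418 (Selmer rank), Assembly keep their kinds.
After that the crux keys no staffing on this route (it already keys none on `ShadowIsolation`, rev 4).
-/

set_option linter.dupNamespace false

namespace Summit.BirchSwinnertonDyer.BirchSwinnertonDyer.Theses.NormCapitulation

/-- **`closes` without `R`.** The conclusion of the route's deciding theorem from its hypotheses MINUS
`hRed : ShaCotorsionReducible` PLUS the proved supply `hPS` (statement of stmt-15491 verbatim). Body: the
`Assembly` item applied to (Selmer-rank BSD ∧ Ш-cotorsion at every good ordinary `p ≥ 5`): Selmer rank by the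
image dichotomy (`SelmerRankUB ∧ SelmerRankLB` / `SelmerRankSmallImage`); Ш-cotorsion by the junction
(`UniversalNorm`, `NormHerbrandBound`, `PhantomCapitulation`, `CapitulationSqueeze`) when `E[p]` is
irreducible, and otherwise via an auxiliary irreducible prime `q` from `hPS`, the junction and the dichotomy
at `q`, and Greenberg's identity at `q` and at `p`. [cite: Greenberg1999LNM, §1 pp. 54–57]
[cite: SilvermanAEC2009, Cor. IX.6.3] [cite: Bertolini1995, Introduction] -/
theorem closes_without_shaCotorsionReducible (hUN : UniversalNorm) (hCap : PhantomCapitulation)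
    (hHerb : NormHerbrandBound) (hSq : CapitulationSqueeze) (hUB : SelmerRankUB) (hLB : SelmerRankLB)
    (hSI : SelmerRankSmallImage)
    (hPS : ∀ (W : WeierstrassCurve ℚ) [W.IsElliptic] [W.IsGloballyMinimal], ∃ (p : ℕ) (_ : Fact p.Prime), 5 ≤ p ∧ W.HasGoodReductionAtPrime p ∧ ¬ (p : ℤ) ∣ W.frobeniusTrace p ∧ W.HasIrreducibleModPGaloisRep p)
    (hA : Assembly) : _root_.BirchSwinnertonDyer := by
  classical
  refine hA ?_
  intro V iV iM p ip h5 hgood hord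
  -- Selmer-rank BSD at every good ordinary prime ≥ 5 of V, by the mod-q image dichotomy
  have hsel : ∀ (q : ℕ) [Fact q.Prime], 5 ≤ q → V.HasGoodReductionAtPrime q →
      ¬ (q : ℤ) ∣ V.frobeniusTrace q → V.selmerCorank q = V.analyticRank := by
    intro q _ h5q hqgood hqord
    by_cases hsurj : V.HasSurjectiveModNGaloisRep q
    · exact le_antisymm (hUB V q h5q hqgood hqord hsurj) (hLB V q h5q hqgood hqord hsurj)
    · exact hSI V q h5q hqgood hqord hsurj
  -- Ш-cotorsion at every good ordinary IRREDUCIBLE prime ≥ 5 of V, by the junction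
  have hjct : ∀ (q : ℕ) [Fact q.Prime], 5 ≤ q → V.HasGoodReductionAtPrime q →
      ¬ (q : ℤ) ∣ V.frobeniusTrace q → V.HasIrreducibleModPGaloisRep q → V.shaCorank q = 0 := by
    intro q _ h5q hqgood hqord hqirr
    obtain ⟨K, iK, iNK, hK, κ, hκ, hdatum⟩ := hUN V q h5q hqgood hqord hqirr
    exact hSq V q h5q hqgood hqord hqirr K hK κ hκ (hCap V q h5q hqgood hqord hqirr K hK κ hκ)
      (hHerb V q h5q hqgood hqord hqirr K hK κ hκ hdatum)
  refine ⟨hsel p h5 hgood hord, ?_⟩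
  by_cases hirr : V.HasIrreducibleModPGaloisRep p
  · exact hjct p h5 hgood hord hirr
  · -- Eisenstein p: auxiliary irreducible prime q, Greenberg's identity at q and at p
    obtain ⟨q, hq, h5q, hqgood, hqord, hqirr⟩ := hPS V
    haveI := hq
    have hshaq : V.shaCorank q = 0 := hjct q h5q hqgood hqord hqirr
    have hselq : V.selmerCorank q = V.analyticRank := hsel q h5q hqgood hqord
    have hIdq : V.selmerCorank q = V.mordellWeilRank + V.shaCorank q :=
      V.selmerCorank_eq_mordellWeilRank_add_holds q
    have hselp : V.selmerCorank p = V.analyticRank := hsel p h5 hgood hord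
    have hIdp : V.selmerCorank p = V.mordellWeilRank + V.shaCorank p :=
      V.selmerCorank_eq_mordellWeilRank_add_holds p
    omega

end Summit.BirchSwinnertonDyer.BirchSwinnertonDyer.Theses.NormCapitulation
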